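import Summits.CriticalPhenomena.PercolationContinuityZ3.Theorems.Transplant.SkelPhiFaceKitClause
import Summits.CriticalPhenomena.PercolationContinuityZ3.Theorems.Transplant.SkelPhiEquilibriumWDefs
import HarnessLib

/-!
# N1 ({±1} node), (F) kit layer (hp-8 g33): **EXIT PIECES FOR THE FACE FRAME'S SIDE FORMS** — the exit inequality `hPex` of p1-g11's
# `kitClauseA'` (`L(φ v) + A + C ≤ L(φ c)` on an exit piece of the kit centre `c`) for the four affine side forms of hp-8's face frame
# `pr.frame φ t I b` (`TwoAxisExitFrameSidesU`: slope `D`, climbing coefficients `climC`), proved WITHOUT unfolding the forms: an affine side form's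
# value is pinned to the signed depth by its dictionary, so a DEPTH GAP of `k` levels with `A + C + U ≤ k·U` is an exit (§1, any frame); the depth
# gap is the outward FRAME DISPLACEMENT (§2); and the frame displacement of Martineau–Tassion's short pieces at `c` is read off their defining
# inequalities (§3): raw sides — the x side half (`Δα = ±n_s` exactly) and the y′ top piece (`±Δβ ≥ ℓ_s − |h_s| − …`); level sides — `I = 1`
# (`β′_L`-levels): the top piece through the shear transfer `n_s β′_L = n_L β′_s + (n_L h_s − h_L n_s) α`, `I = 0` (levels along `v_L`): the side half
# with signs chosen against `v_β, v_α`.  p1-g11 2026-08-21T16:37:13Z: "your frame, your forms" (templates `exit_rawSideU_sideHalf/exit_levSide_topPiece`).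

builds on p205010 (kernel theorem, internal audit signed; external expert review pending) — nothing in this file uses p205010; nothing here is a
claim about the open node `SamePDropOfSkeletonNeg`.
Lane `prim-bschramm`, seat `prim-hp-8` (gen 33); helper file (`--supports stmt-CriticalPhenomena-4575 --as helper`).
* §1 `SideForm.exit_of_depth_gap` (any affine side form); §2 `depth_gap_of_disp`;
* §3 frame displacements: `FinePrm.frame_sub_raw`, `disp_raw_sideHalf` (`b = 0`), `disp_raw_topPiece` (`b = 1`), `le_coarse_sub_of_mul`,
  `FinePrm.frame_sub_lv_one/zero`, `disp_lv_one_topPiece`, `disp_lv_zero_sideHalf`;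
* §4 the four exits for `pr.sideFormsU_frame`: **`exit_frame_raw_sideHalf`**, **`exit_frame_raw_topPiece`**, **`exit_frame_lv_one_topPiece`**,
  **`exit_frame_lv_zero_sideHalf`**.
[cite: MartineauTassion2017, §3.2 (the pieces L(−a,v), L(v,b), the side halves)] [cite: KozmaNitzan2024, §4 Lemma 10 Step IV (pp. 20–21)]
-/

noncomputable section

open scoped Classical

namespace Summit.CriticalPhenomena.PercolationContinuityZ3.Theorems.Transplant

namespace Skelφ

open Literature.Probability.Percolation Literature.Probability.LatticeModels SimpleGraph
open Literature.Probability.Percolation.KozmaNitzan.Cells (oth oth_ne eq_oth_of_ne oth_oth)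
open TwoAxis.Para (coarse lam0 lam1 bp)

variable {V : Type} {G : SimpleGraph V} [G.LocallyFinite] {ψ φ : V → Site 2}

/-! ## §1 An affine side form exits on a depth gap -/

omit [G.LocallyFinite] in
/-- **EXIT FROM A DEPTH GAP**: for an affine side form (slope `U ≥ 0`, climbing coefficient `C`), if `v` is `k` levels less deep than `c` behind the
side and `A + C + U ≤ k·U`, then `L(φ v) + A + C ≤ L(φ c)` (the dictionary pins `L(φ ·)` within one slope of `θ(depth)`).
[cite: KozmaNitzan2024, §4 Lemma 10 Step IV (pp. 20–21)] -/
theorem SideForm.exit_of_depth_gap {Lo Hi : Site 2} {i : Fin 2} {σ₀ : ℤˣ} (F : SideForm ψ φ Lo Hi i σ₀) {U C : ℤ} (hF : F.IsAffine U C)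
    (hU : 0 ≤ U) {A k : ℤ} (hk : A + C + U ≤ k * U) {c v : V} (hgap : sdepth ψ Lo Hi i σ₀ v + k ≤ sdepth ψ Lo Hi i σ₀ c) :
    F.lin (φ v) + A + C ≤ F.lin (φ c) := by
  have h1 : F.lin (φ v) < F.θ (sdepth ψ Lo Hi i σ₀ v + 1) := by
    have h := (F.depth_iff v (sdepth ψ Lo Hi i σ₀ v + 1)).2
    by_contra hc
    push Not at hc
    have := h hc
    omega
  have h2 : F.θ (sdepth ψ Lo Hi i σ₀ c) ≤ F.lin (φ c) := (F.depth_iff c _).1 le_rfl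
  have h3 := hF.θ_sub (sdepth ψ Lo Hi i σ₀ v + 1) (sdepth ψ Lo Hi i σ₀ c)
  have h4 : (k - 1) * U ≤ (sdepth ψ Lo Hi i σ₀ c - (sdepth ψ Lo Hi i σ₀ v + 1)) * U :=
    mul_le_mul_of_nonneg_right (by omega) hU
  nlinarith

/-! ## §2 The depth gap is the outward frame displacement -/

omit [G.LocallyFinite] in
/-- `k ≤ σ₀·(ψ v i − ψ c i)` gives the depth gap `sdepth v + k ≤ sdepth c`. [folklore] -/
theorem depth_gap_of_disp {Lo Hi : Site 2} {i : Fin 2} {σ₀ : ℤˣ} {k : ℤ} {c v : V} (h : k ≤ (σ₀ : ℤ) * (ψ v i - ψ c i)) :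
    sdepth ψ Lo Hi i σ₀ v + k ≤ sdepth ψ Lo Hi i σ₀ c := by
  unfold sdepth
  have hσ : (σ₀ : ℤ) = 1 ∨ (σ₀ : ℤ) = -1 := by rcases Int.units_eq_one_or σ₀ with h | h <;> simp [h]
  rcases hσ with h1 | h1
  · rw [if_pos h1, if_pos h1]; rw [h1] at h; linarith
  · rw [if_neg (by rw [h1]; norm_num), if_neg (by rw [h1]; norm_num)]; rw [h1] at h; linarith

/-! ## §3 Frame displacements of the short pieces -/

namespace FinePrm

variable (pr : FinePrm) (φ : V → Site 2) (t : V)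

omit [G.LocallyFinite] in
/-- Raw-coordinate displacement in the face frame is the raw `φ`-displacement. [folklore] -/
theorem frame_sub_raw (I b : Fin 2) (v c : V) : pr.frame φ t I b v (oth I) - pr.frame φ t I b c (oth I) = relCoord φ c b v := by
  rw [pr.frame_apply_raw, pr.frame_apply_raw, relCoord_apply]; simp [relφ]

omit [G.LocallyFinite] in
/-- Level-coordinate `1` of the face frame is the coarse `λ₁`-coordinate. [folklore] -/
theorem frame_apply_lv_one (b : Fin 2) (w : V) :
    pr.frame φ t 1 b w 1 = coarse pr.c₁ (pr.D / 2) pr.D (lam1 pr.A pr.n pr.h (relφ φ t w)) := by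
  rw [pr.frame_apply_lv]; rfl

omit [G.LocallyFinite] in
/-- Level-coordinate `0` of the face frame is the coarse `λ₀`-coordinate. [folklore] -/
theorem frame_apply_lv_zero (b : Fin 2) (w : V) :
    pr.frame φ t 0 b w 0 = coarse pr.c₀ (pr.D / 2) pr.D (lam0 pr.A pr.vα pr.vβ (relφ φ t w)) := by
  rw [pr.frame_apply_lv]; rfl

end FinePrm

omit [G.LocallyFinite] in
/-- **Coarse coordinates separate by `k` when the fine values separate by `(k+1)·D`** (`0 < D`). [folklore] -/
theorem le_coarse_sub_of_mul {c s D a a' k : ℤ} (hD : 0 < D) (h : (k + 1) * D ≤ c * a - c * a') :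
    k ≤ coarse c s D a - coarse c s D a' := by
  unfold coarse
  have h1 : (c * a' + s + (k + 1) * D) / D ≤ (c * a + s) / D := Int.ediv_le_ediv hD (by linarith)
  rw [Int.add_mul_ediv_right _ _ hD.ne'] at h1
  linarith

omit [G.LocallyFinite] in
/-- `λ₁` is linear: its displacement from `c` is `A·(n Δβ − h Δα)`. [folklore] -/
theorem lam1_relφ_sub (A n h : ℤ) (t c v : V) :
    lam1 A n h (relφ φ t v) - lam1 A n h (relφ φ t c) = A * (n * (φ v 1 - φ c 1) - h * (φ v 0 - φ c 0)) := by
  simp only [lam1, bp, relφ]; ring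

omit [G.LocallyFinite] in
/-- `λ₀` is linear: its displacement from `c` is `A·(v_β Δα − v_α Δβ)`. [folklore] -/
theorem lam0_relφ_sub (A vα vβ : ℤ) (t c v : V) :
    lam0 A vα vβ (relφ φ t v) - lam0 A vα vβ (relφ φ t c) = A * (vβ * (φ v 0 - φ c 0) - vα * (φ v 1 - φ c 1)) := by
  simp only [lam0, relφ]; ring

/-- **x side half, raw axis `α`**: on `pgSideHalfW c n_s h_s ℓ_s R σ τ`, `σ·Δα = n_s` (`σ = ±1`). [cite: MartineauTassion2017, §3.2] -/
theorem disp_raw_sideHalf {c : V} {nS : ℕ} {hS : ℤ} {ℓS R : ℕ} {σ τ : ℤ} (hσ : σ = 1 ∨ σ = -1) {v : V}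
    (hv : v ∈ pgSideHalfW G φ c nS hS ℓS R σ τ) : σ * relCoord φ c 0 v = nS := by
  obtain ⟨-, -, hα, -⟩ := (mem_pgSideHalfW G φ).1 hv
  rw [hα, ← mul_assoc]
  rcases hσ with rfl | rfl <;> simp

/-- **y′ top piece, raw axis `β`**: on `pgTopPieceW c n_s h_s ℓ_s R σ τ v₀`, `k ≤ σ·Δβ` as soon as `k·n_s ≤ n_s ℓ_s − U_s + 1 − |h_s|·n_s` (`1 ≤ n_s`).
[cite: MartineauTassion2017, §3.2] -/
theorem disp_raw_topPiece {c : V} {nS : ℕ} (hnS : 1 ≤ nS) {hS : ℤ} {ℓS R : ℕ} {σ τ v₀ : ℤ} (hσ : σ = 1 ∨ σ = -1) {k : ℤ}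
    (hk : k * nS ≤ (nS : ℤ) * ℓS - (shearUnit nS hS : ℤ) + 1 - |hS| * nS) {v : V} (hv : v ∈ pgTopPieceW G φ c nS hS ℓS R σ τ v₀) :
    k ≤ σ * relCoord φ c 1 v := by
  obtain ⟨-, hcyl, htop, -⟩ := (mem_pgTopPieceW G φ).1 hv
  rw [mem_pgramCyl] at hcyl
  have hα := abs_le.1 hcyl.1
  have hσ1 : |σ| = 1 := by rcases hσ with rfl | rfl <;> simp
  have hnS0 : (0 : ℤ) < nS := by exact_mod_cast hnS
  -- `n_s (σ Δβ) = σ β′_s + σ h_s Δα`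
  have e : (nS : ℤ) * (σ * relCoord φ c 1 v) = σ * shearCoord φ c nS hS v + σ * hS * relCoord φ c 0 v := by
    simp only [shearCoord_apply, relCoord_apply]; ring
  have hb : -(|hS| * nS) ≤ σ * hS * relCoord φ c 0 v := by
    have : |σ * hS * relCoord φ c 0 v| ≤ |hS| * nS := by
      rw [abs_mul, abs_mul, hσ1, one_mul]; exact mul_le_mul_of_nonneg_left hcyl.1 (abs_nonneg _)
    exact (abs_le.1 this).1
  have hU : ((shearUnit nS hS : ℕ) : ℤ) = ((nS + hS.natAbs : ℕ) : ℤ) := rfl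
  have h1 : k * nS ≤ (nS : ℤ) * (σ * relCoord φ c 1 v) := by rw [e]; push_cast [hU] at hk htop ⊢; linarith
  by_contra hc
  push Not at hc
  have : (nS : ℤ) * (σ * relCoord φ c 1 v) < k * nS := by nlinarith
  linarith

/-- **y′ top piece, level axis `I = 1`** (`β′_L`-levels of the long data `(A, n, h)`, `0 < A`, `0 ≤ n`): on `pgTopPieceW c n_s h_s ℓ_s R σ τ v₀`,
`A·(n (n_s ℓ_s − U_s + 1) − |n h_s − h n_s|·n_s) ≤ n_s·σ·A·(n Δβ − h Δα)` (shear transfer). [cite: MartineauTassion2017, §3.2] -/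
theorem disp_lv_one_topPiece {c : V} {nS : ℕ} {hS : ℤ} {ℓS R : ℕ} {σ τ v₀ : ℤ} (hσ : σ = 1 ∨ σ = -1) {A n h : ℤ}
    (hA : 0 < A) (hn : 0 ≤ n) {v : V} (hv : v ∈ pgTopPieceW G φ c nS hS ℓS R σ τ v₀) :
    A * (n * ((nS : ℤ) * ℓS - (shearUnit nS hS : ℤ) + 1) - |n * hS - h * nS| * nS) ≤
      (nS : ℤ) * (σ * (A * (n * (φ v 1 - φ c 1) - h * (φ v 0 - φ c 0)))) := by
  obtain ⟨-, hcyl, htop, -⟩ := (mem_pgTopPieceW G φ).1 hv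
  rw [mem_pgramCyl] at hcyl
  have hσ1 : |σ| = 1 := by rcases hσ with rfl | rfl <;> simp
  -- shear transfer: `n_s (n Δβ − h Δα) = n β′_s + (n h_s − h n_s) Δα`
  have e : (nS : ℤ) * (n * (φ v 1 - φ c 1) - h * (φ v 0 - φ c 0)) =
      n * shearCoord φ c nS hS v + (n * hS - h * nS) * relCoord φ c 0 v := by
    simp only [shearCoord_apply, relCoord_apply]; ring
  have hE : -(|n * hS - h * nS| * nS) ≤ σ * ((n * hS - h * nS) * relCoord φ c 0 v) := by
    have : |σ * ((n * hS - h * nS) * relCoord φ c 0 v)| ≤ |n * hS - h * nS| * nS := by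
      rw [abs_mul, abs_mul, hσ1, one_mul]; exact mul_le_mul_of_nonneg_left hcyl.1 (abs_nonneg _)
    exact (abs_le.1 this).1
  have hU : ((shearUnit nS hS : ℕ) : ℤ) = ((nS + hS.natAbs : ℕ) : ℤ) := rfl
  have htop' : (nS : ℤ) * ℓS - (shearUnit nS hS : ℤ) + 1 ≤ σ * shearCoord φ c nS hS v := by push_cast [hU] at htop ⊢; omega
  have h1 : n * ((nS : ℤ) * ℓS - (shearUnit nS hS : ℤ) + 1) - |n * hS - h * nS| * nS ≤
      σ * ((nS : ℤ) * (n * (φ v 1 - φ c 1) - h * (φ v 0 - φ c 0))) := by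
    have e2 : σ * ((nS : ℤ) * (n * (φ v 1 - φ c 1) - h * (φ v 0 - φ c 0))) =
        n * (σ * shearCoord φ c nS hS v) + σ * ((n * hS - h * nS) * relCoord φ c 0 v) := by rw [e]; ring
    rw [e2]
    have := mul_le_mul_of_nonneg_left htop' hn
    linarith
  have h3 := mul_le_mul_of_nonneg_left h1 hA.le
  calc A * (n * ((nS : ℤ) * ℓS - (shearUnit nS hS : ℤ) + 1) - |n * hS - h * nS| * nS)
      ≤ A * (σ * ((nS : ℤ) * (n * (φ v 1 - φ c 1) - h * (φ v 0 - φ c 0)))) := h3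
    _ = (nS : ℤ) * (σ * (A * (n * (φ v 1 - φ c 1) - h * (φ v 0 - φ c 0)))) := by ring

/-- **x side half, level axis `I = 0`** (levels along `v_L = (v_α, v_β)` of the long data, `0 < A`): on the side half `pgSideHalfW c n_s h_s ℓ_s R (σ₀e) (−σ₀f)`
with `e v_β = |v_β|`, `f v_α = |v_α|` (`σ₀, e, f = ±1`), `A·(|v_β| n_s − |v_α| |h_s|) ≤ σ₀·A·(v_β Δα − v_α Δβ)` (`1 ≤ n_s`).
[cite: MartineauTassion2017, §3.2] -/
theorem disp_lv_zero_sideHalf {c : V} {nS : ℕ} (hnS : 1 ≤ nS) {hS : ℤ} {ℓS R : ℕ} {σ₀ e f : ℤ} (hσ₀ : σ₀ = 1 ∨ σ₀ = -1)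
    (he : e = 1 ∨ e = -1) (hf : f = 1 ∨ f = -1) {A vα vβ : ℤ} (hA : 0 < A) (hev : e * vβ = |vβ|) (hfv : f * vα = |vα|)
    {v : V} (hv : v ∈ pgSideHalfW G φ c nS hS ℓS R (σ₀ * e) (-(σ₀ * f))) :
    A * (|vβ| * nS - |vα| * |hS|) ≤ σ₀ * (A * (vβ * (φ v 0 - φ c 0) - vα * (φ v 1 - φ c 1))) := by
  obtain ⟨-, -, hα, hτ⟩ := (mem_pgSideHalfW G φ).1 hv
  have hnS0 : (0 : ℤ) < nS := by exact_mod_cast hnS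
  rw [relCoord_apply] at hα
  -- `n_s Δβ = β′_s + h_s Δα`
  have eβ : (nS : ℤ) * (φ v 1 - φ c 1) = shearCoord φ c nS hS v + hS * (φ v 0 - φ c 0) := by
    simp only [shearCoord_apply]; ring
  -- `n_s · σ₀ (v_β Δα − v_α Δβ) = |v_β| n_s² + |v_α| (τ β′_s) − e (v_α h_s n_s)`
  have key : (nS : ℤ) * (σ₀ * (vβ * (φ v 0 - φ c 0) - vα * (φ v 1 - φ c 1))) =
      |vβ| * nS * nS + |vα| * (-(σ₀ * f) * shearCoord φ c nS hS v) - e * (vα * hS * nS) := by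
    have e1 : (nS : ℤ) * (σ₀ * (vβ * (φ v 0 - φ c 0) - vα * (φ v 1 - φ c 1))) =
        σ₀ * vβ * nS * (φ v 0 - φ c 0) - σ₀ * vα * ((nS : ℤ) * (φ v 1 - φ c 1)) := by ring
    rw [e1, eβ, hα, ← hev, ← hfv]
    rcases hσ₀ with rfl | rfl <;> rcases hf with rfl | rfl <;> ring
  have hτ' : 0 ≤ |vα| * (-(σ₀ * f) * shearCoord φ c nS hS v) := mul_nonneg (abs_nonneg _) hτ
  have hh : e * (vα * hS * nS) ≤ |vα| * |hS| * nS := by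
    have he' : |e| = 1 := by rcases he with rfl | rfl <;> simp
    have : |e * (vα * hS * nS)| ≤ |vα| * |hS| * nS := by rw [abs_mul, he', one_mul, abs_mul, abs_mul, Nat.abs_cast]
    exact (abs_le.1 this).2
  have h0 : (|vβ| * nS - |vα| * |hS|) * nS ≤ (nS : ℤ) * (σ₀ * (vβ * (φ v 0 - φ c 0) - vα * (φ v 1 - φ c 1))) := by
    rw [key]; nlinarith
  have h0' : |vβ| * nS - |vα| * |hS| ≤ σ₀ * (vβ * (φ v 0 - φ c 0) - vα * (φ v 1 - φ c 1)) :=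
    le_of_mul_le_mul_right (by linarith) hnS0
  calc A * (|vβ| * nS - |vα| * |hS|) ≤ A * (σ₀ * (vβ * (φ v 0 - φ c 0) - vα * (φ v 1 - φ c 1))) :=
        mul_le_mul_of_nonneg_left h0' hA.le
    _ = σ₀ * (A * (vβ * (φ v 0 - φ c 0) - vα * (φ v 1 - φ c 1))) := by ring

/-! ## §4 The four exits for the face frame's side forms -/

namespace FinePrm

variable (pr : FinePrm) (φ : V → Site 2) (t : V)

/-- **RAW-SIDE EXIT BY THE x SIDE HALF** (raw axis `b = 0`): for the raw side `(oth I, σ₀)` of a face-frame box and a kit centre `c`, every vertex of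
`pgSideHalfW c n_s h_s ℓ_s R σ₀ τ` satisfies `L(φ v) + A' + climC ≤ L(φ c)` once `A' + 2D ≤ n_s·D`. [cite: MartineauTassion2017, §3.2] -/
theorem exit_frame_raw_sideHalf (I : Fin 2) (hc : 0 < pr.cOf I) (hA : pr.A ≠ 0) (hnz : pr.lvGen I 0 ≠ 0) (hD : 0 < pr.D)
    (hL : pr.cOf I * pr.L I ≤ pr.D) (Lo Hi : Site 2) (σ₀ : ℤˣ) {A' : ℤ} {nS : ℕ} (hexit : A' + 2 * pr.D ≤ (nS : ℤ) * pr.D)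
    {c : V} {hS : ℤ} {ℓS R : ℕ} {τ : ℤ} {v : V} (hv : v ∈ pgSideHalfW G φ c nS hS ℓS R (σ₀ : ℤ) τ) :
    (pr.sideFormsU_frame φ t I 0 hc hA hnz hD Lo Hi (oth I) σ₀).lin (φ v) + A' + pr.climC I 0 (oth I) ≤
      (pr.sideFormsU_frame φ t I 0 hc hA hnz hD Lo Hi (oth I) σ₀).lin (φ c) := by
  have hC : pr.climC I 0 (oth I) = pr.D := by unfold climC; rw [if_neg (oth_ne I)]
  have hσ : (σ₀ : ℤ) = 1 ∨ (σ₀ : ℤ) = -1 := by rcases Int.units_eq_one_or σ₀ with h | h <;> simp [h]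
  refine SideForm.exit_of_depth_gap _ (pr.sideFormsU_frame_isAffine φ t I 0 hc hA hnz hD hL Lo Hi (oth I) σ₀) hD.le (k := nS)
    (by rw [hC]; linarith) (depth_gap_of_disp ?_)
  rw [pr.frame_sub_raw, disp_raw_sideHalf hσ hv]

/-- **RAW-SIDE EXIT BY THE y′ TOP PIECE** (raw axis `b = 1`): every vertex of `pgTopPieceW c n_s h_s ℓ_s R σ₀ τ v₀` satisfies
`L(φ v) + A' + climC ≤ L(φ c)` once `A' + 2D ≤ k·D` and `k·n_s ≤ n_s ℓ_s − U_s + 1 − |h_s| n_s`. [cite: MartineauTassion2017, §3.2] -/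
theorem exit_frame_raw_topPiece (I : Fin 2) (hc : 0 < pr.cOf I) (hA : pr.A ≠ 0) (hnz : pr.lvGen I 1 ≠ 0) (hD : 0 < pr.D)
    (hL : pr.cOf I * pr.L I ≤ pr.D) (Lo Hi : Site 2) (σ₀ : ℤˣ) {A' k : ℤ} (hexit : A' + 2 * pr.D ≤ k * pr.D) {nS : ℕ} (hnS : 1 ≤ nS)
    {hS : ℤ} {ℓS : ℕ} (hk : k * nS ≤ (nS : ℤ) * ℓS - (shearUnit nS hS : ℤ) + 1 - |hS| * nS)
    {c : V} {R : ℕ} {τ v₀ : ℤ} {v : V} (hv : v ∈ pgTopPieceW G φ c nS hS ℓS R (σ₀ : ℤ) τ v₀) :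
    (pr.sideFormsU_frame φ t I 1 hc hA hnz hD Lo Hi (oth I) σ₀).lin (φ v) + A' + pr.climC I 1 (oth I) ≤
      (pr.sideFormsU_frame φ t I 1 hc hA hnz hD Lo Hi (oth I) σ₀).lin (φ c) := by
  have hC : pr.climC I 1 (oth I) = pr.D := by unfold climC; rw [if_neg (oth_ne I)]
  have hσ : (σ₀ : ℤ) = 1 ∨ (σ₀ : ℤ) = -1 := by rcases Int.units_eq_one_or σ₀ with h | h <;> simp [h]
  refine SideForm.exit_of_depth_gap _ (pr.sideFormsU_frame_isAffine φ t I 1 hc hA hnz hD hL Lo Hi (oth I) σ₀) hD.le (k := k)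
    (by rw [hC]; linarith) (depth_gap_of_disp ?_)
  rw [pr.frame_sub_raw]
  exact disp_raw_topPiece hnS hσ hk hv

/-- **LEVEL-SIDE EXIT, `I = 1`, BY THE y′ TOP PIECE**: for the level side `(1, σ₀)` of a u-face frame box (`0 < A`, `0 ≤ n`), every vertex of
`pgTopPieceW c n_s h_s ℓ_s R σ₀ τ v₀` satisfies `L(φ v) + A' + climC ≤ L(φ c)` once `A' + climC 1 b 1 + D ≤ k·D` and
`(k+1)·D·n_s ≤ c₁·A·(n (n_s ℓ_s − U_s + 1) − |n h_s − h n_s| n_s)`. [cite: MartineauTassion2017, §3.2] -/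
theorem exit_frame_lv_one_topPiece (b : Fin 2) (hc : 0 < pr.cOf 1) (hA : pr.A ≠ 0) (hnz : pr.lvGen 1 b ≠ 0) (hD : 0 < pr.D)
    (hL : pr.cOf 1 * pr.L 1 ≤ pr.D) (Lo Hi : Site 2) (σ₀ : ℤˣ) (hA0 : 0 < pr.A) (hn : 0 ≤ pr.n) {A' k : ℤ}
    (hexit : A' + pr.climC 1 b 1 + pr.D ≤ k * pr.D) {nS : ℕ} (hnS : 1 ≤ nS) {hS : ℤ} {ℓS : ℕ}
    (hk : (k + 1) * pr.D * nS ≤ pr.c₁ * (pr.A * (pr.n * ((nS : ℤ) * ℓS - (shearUnit nS hS : ℤ) + 1) - |pr.n * hS - pr.h * nS| * nS)))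
    {c : V} {R : ℕ} {τ v₀ : ℤ} {v : V} (hv : v ∈ pgTopPieceW G φ c nS hS ℓS R (σ₀ : ℤ) τ v₀) :
    (pr.sideFormsU_frame φ t 1 b hc hA hnz hD Lo Hi 1 σ₀).lin (φ v) + A' + pr.climC 1 b 1 ≤
      (pr.sideFormsU_frame φ t 1 b hc hA hnz hD Lo Hi 1 σ₀).lin (φ c) := by
  have hσ : (σ₀ : ℤ) = 1 ∨ (σ₀ : ℤ) = -1 := by rcases Int.units_eq_one_or σ₀ with h | h <;> simp [h]
  have hnS0 : (0 : ℤ) < nS := by exact_mod_cast hnS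
  have hc₁ : 0 < pr.c₁ := by have := pr.cOf_one; rw [this] at hc; exact hc
  refine SideForm.exit_of_depth_gap _ (pr.sideFormsU_frame_isAffine φ t 1 b hc hA hnz hD hL Lo Hi 1 σ₀) hD.le (k := k) hexit
    (depth_gap_of_disp ?_)
  rw [pr.frame_apply_lv_one, pr.frame_apply_lv_one]
  set lv := lam1 pr.A pr.n pr.h (relφ φ t v) with hlv
  set lc := lam1 pr.A pr.n pr.h (relφ φ t c) with hlc
  -- `σ₀ (coarse λ₁ v − coarse λ₁ c) ≥ k` from `σ₀ c₁ (λ₁ v − λ₁ c) ≥ (k+1) D`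
  have hM : (k + 1) * pr.D ≤ (σ₀ : ℤ) * (pr.c₁ * (lv - lc)) := by
    rw [hlv, hlc, lam1_relφ_sub]
    have h0 := disp_lv_one_topPiece (G := G) hσ hA0 hn (h := pr.h) hv
    have h1 : (k + 1) * pr.D * nS ≤
        (nS : ℤ) * ((σ₀ : ℤ) * (pr.c₁ * (pr.A * (pr.n * (φ v 1 - φ c 1) - pr.h * (φ v 0 - φ c 0))))) := by
      have h2 := mul_le_mul_of_nonneg_left h0 hc₁.le
      calc (k + 1) * pr.D * nS ≤ _ := hk
        _ ≤ _ := h2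
        _ = _ := by ring
    by_contra hcn
    push Not at hcn
    have : (nS : ℤ) * ((σ₀ : ℤ) * (pr.c₁ * (pr.A * (pr.n * (φ v 1 - φ c 1) - pr.h * (φ v 0 - φ c 0))))) < (k + 1) * pr.D * nS := by
      nlinarith
    linarith
  have hms := mul_sub pr.c₁ lv lc
  rcases hσ with h1 | h1
  · rw [h1, one_mul] at hM
    rw [h1, one_mul]
    exact le_coarse_sub_of_mul hD (by linarith)
  · rw [h1, neg_one_mul] at hM
    rw [h1, neg_one_mul, neg_sub]
    exact le_coarse_sub_of_mul hD (by linarith)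

/-- **LEVEL-SIDE EXIT, `I = 0`, BY THE x SIDE HALF**: for the level side `(0, σ₀)` of a v-face frame box (`0 < A`), with signs `e v_β = |v_β|`,
`f v_α = |v_α|`, every vertex of `pgSideHalfW c n_s h_s ℓ_s R (σ₀e) (−σ₀f)` satisfies `L(φ v) + A' + climC ≤ L(φ c)` once
`A' + climC 0 b 0 + D ≤ k·D` and `(k+1)·D ≤ c₀·A·(|v_β| n_s − |v_α| |h_s|)`. [cite: MartineauTassion2017, §3.2] -/
theorem exit_frame_lv_zero_sideHalf (b : Fin 2) (hc : 0 < pr.cOf 0) (hA : pr.A ≠ 0) (hnz : pr.lvGen 0 b ≠ 0) (hD : 0 < pr.D)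
    (hL : pr.cOf 0 * pr.L 0 ≤ pr.D) (Lo Hi : Site 2) (σ₀ : ℤˣ) (hA0 : 0 < pr.A) {e f : ℤ} (he : e = 1 ∨ e = -1) (hf : f = 1 ∨ f = -1)
    (hev : e * pr.vβ = |pr.vβ|) (hfv : f * pr.vα = |pr.vα|) {A' k : ℤ} (hexit : A' + pr.climC 0 b 0 + pr.D ≤ k * pr.D) {nS : ℕ} (hnS : 1 ≤ nS)
    {hS : ℤ} (hk : (k + 1) * pr.D ≤ pr.c₀ * (pr.A * (|pr.vβ| * nS - |pr.vα| * |hS|))) {c : V} {ℓS R : ℕ} {v : V}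
    (hv : v ∈ pgSideHalfW G φ c nS hS ℓS R ((σ₀ : ℤ) * e) (-((σ₀ : ℤ) * f))) :
    (pr.sideFormsU_frame φ t 0 b hc hA hnz hD Lo Hi 0 σ₀).lin (φ v) + A' + pr.climC 0 b 0 ≤
      (pr.sideFormsU_frame φ t 0 b hc hA hnz hD Lo Hi 0 σ₀).lin (φ c) := by
  have hσ : (σ₀ : ℤ) = 1 ∨ (σ₀ : ℤ) = -1 := by rcases Int.units_eq_one_or σ₀ with h | h <;> simp [h]
  have hc₀ : 0 < pr.c₀ := by have := pr.cOf_zero; rw [this] at hc; exact hc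
  refine SideForm.exit_of_depth_gap _ (pr.sideFormsU_frame_isAffine φ t 0 b hc hA hnz hD hL Lo Hi 0 σ₀) hD.le (k := k) hexit
    (depth_gap_of_disp ?_)
  rw [pr.frame_apply_lv_zero, pr.frame_apply_lv_zero]
  set lv := lam0 pr.A pr.vα pr.vβ (relφ φ t v) with hlv
  set lc := lam0 pr.A pr.vα pr.vβ (relφ φ t c) with hlc
  have hM : (k + 1) * pr.D ≤ (σ₀ : ℤ) * (pr.c₀ * (lv - lc)) := by
    rw [hlv, hlc, lam0_relφ_sub]
    have h0 := disp_lv_zero_sideHalf (G := G) hnS hσ he hf hA0 hev hfv hv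
    have h2 := mul_le_mul_of_nonneg_left h0 hc₀.le
    calc (k + 1) * pr.D ≤ pr.c₀ * (pr.A * (|pr.vβ| * nS - |pr.vα| * |hS|)) := hk
      _ ≤ pr.c₀ * ((σ₀ : ℤ) * (pr.A * (pr.vβ * (φ v 0 - φ c 0) - pr.vα * (φ v 1 - φ c 1)))) := h2
      _ = _ := by ring
  have hms := mul_sub pr.c₀ lv lc
  rcases hσ with h1 | h1
  · rw [h1, one_mul] at hM
    rw [h1, one_mul]
    exact le_coarse_sub_of_mul hD (by linarith)
  · rw [h1, neg_one_mul] at hM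
    rw [h1, neg_one_mul, neg_sub]
    exact le_coarse_sub_of_mul hD (by linarith)

end FinePrm

end Skelφ

end Summit.CriticalPhenomena.PercolationContinuityZ3.Theorems.Transplant

end
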